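import Summits.AtomisticToContinuum.Crystallization.Theorems.ExcessDecayLiouvillePhononStabilityCertPsi

/-!
# Near-certificate layer V5-c1: rational interval arithmetic, inclusion-monotone (lead c2, vertex scheme)

Support file for crux `PhononStability` (stmt-AtomisticToContinuum-9333), line `contragredient-window-collapse`.

A minimal rational interval arithmetic (`Ivl`: `add`, `neg`, `smul`, `mul`, `powInv`, absolute bound `mag`) with the two
properties the vertex scheme needs: SOUNDNESS (`mem_*`: the real value lies in the computed interval) and INCLUSION
MONOTONICITY (`*_mono`: smaller argument intervals give smaller result intervals) — the latter makes the curvature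
dominators of a grid cell lie below those of the enclosing node boxes (node sharing).  On top: the natural interval
extension of sparse scalar polynomials (`spIvl`) and polynomial matrices (`mpIvl`) over a box of variable intervals,
sound (`mem_spIvl`, `mem_mpIvl`) and monotone (`spIvl_mono`, `mpIvl_mono`).
-/

noncomputable section

open scoped BigOperators

namespace Summit.AtomisticToContinuum.Crystallization.Theorems.PhononStabilityCWC.Cert

/-- a rational interval `[lo, hi]` (possibly empty; soundness lemmas carry membership hypotheses) -/
structure Ivl where
  /-- lower end -/
  lo : ℚ
  /-- upper end -/
  hi : ℚ
  deriving DecidableEq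

namespace Ivl

/-- membership of a real number -/
def mem (I : Ivl) (x : ℝ) : Prop := (I.lo : ℝ) ≤ x ∧ x ≤ (I.hi : ℝ)

/-- inclusion `I ⊆ J` (as a `Bool`-valued test and as the induced `Prop`) -/
def sub (I J : Ivl) : Bool := decide (J.lo ≤ I.lo) && decide (I.hi ≤ J.hi)

/-- the point interval -/
def const (a : ℚ) : Ivl := ⟨a, a⟩
/-- sum -/
def add (I J : Ivl) : Ivl := ⟨I.lo + J.lo, I.hi + J.hi⟩
/-- negation -/
def neg (I : Ivl) : Ivl := ⟨-I.hi, -I.lo⟩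
/-- scaling by a rational -/
def smul (a : ℚ) (I : Ivl) : Ivl := if 0 ≤ a then ⟨a * I.lo, a * I.hi⟩ else ⟨a * I.hi, a * I.lo⟩
/-- product -/
def mul (I J : Ivl) : Ivl :=
  ⟨min (min (I.lo * J.lo) (I.lo * J.hi)) (min (I.hi * J.lo) (I.hi * J.hi)),
    max (max (I.lo * J.lo) (I.lo * J.hi)) (max (I.hi * J.lo) (I.hi * J.hi))⟩
/-- inverse power `x ↦ x⁻ⁿ` on a positive interval (junk `[0, 0]` otherwise; callers check positivity) -/
def powInv (n : ℕ) (I : Ivl) : Ivl := if 0 < I.lo then ⟨(I.hi ^ n)⁻¹, (I.lo ^ n)⁻¹⟩ else ⟨0, 0⟩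
/-- magnitude bound `max(|lo|, |hi|)` -/
def mag (I : Ivl) : ℚ := max |I.lo| |I.hi|

/-! ### soundness -/

/-- the point interval contains its point. [folklore] -/
theorem mem_const (a : ℚ) : (const a).mem a := ⟨le_rfl, le_rfl⟩

/-- soundness of `add`. [folklore] -/
theorem mem_add {I J : Ivl} {x y : ℝ} (hx : I.mem x) (hy : J.mem y) : (add I J).mem (x + y) := by
  obtain ⟨h1, h2⟩ := hx; obtain ⟨h3, h4⟩ := hy
  refine ⟨?_, ?_⟩ <;> simp only [add, Rat.cast_add] <;> linarith

/-- soundness of `neg`. [folklore] -/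
theorem mem_neg {I : Ivl} {x : ℝ} (hx : I.mem x) : (neg I).mem (-x) := by
  obtain ⟨h1, h2⟩ := hx
  refine ⟨?_, ?_⟩ <;> simp only [neg, Rat.cast_neg] <;> linarith

/-- soundness of `smul`. [folklore] -/
theorem mem_smul (a : ℚ) {I : Ivl} {x : ℝ} (hx : I.mem x) : (smul a I).mem ((a : ℝ) * x) := by
  obtain ⟨h1, h2⟩ := hx
  unfold smul
  split
  · rename_i ha
    have ha' : (0 : ℝ) ≤ a := by exact_mod_cast ha
    refine ⟨?_, ?_⟩ <;> simp only [Rat.cast_mul]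
    · exact mul_le_mul_of_nonneg_left h1 ha'
    · exact mul_le_mul_of_nonneg_left h2 ha'
  · rename_i ha
    have ha' : (a : ℝ) ≤ 0 := by exact_mod_cast (le_of_lt (not_le.mp ha))
    refine ⟨?_, ?_⟩ <;> simp only [Rat.cast_mul]
    · exact mul_le_mul_of_nonpos_left h2 ha'
    · exact mul_le_mul_of_nonpos_left h1 ha'

/-- a product lies between the extreme endpoint products (real version). [folklore] -/
theorem mul_mem_bounds {a b c d x y : ℝ} (h1 : a ≤ x) (h2 : x ≤ b) (h3 : c ≤ y) (h4 : y ≤ d) :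
    min (min (a * c) (a * d)) (min (b * c) (b * d)) ≤ x * y ∧ x * y ≤ max (max (a * c) (a * d)) (max (b * c) (b * d)) := by
  -- `x*y` is between `a*y` and `b*y`; each of these is between its two endpoint products
  have hxy : min (a * y) (b * y) ≤ x * y ∧ x * y ≤ max (a * y) (b * y) := by
    rcases le_total 0 y with hy | hy
    · exact ⟨(min_le_left _ _).trans (mul_le_mul_of_nonneg_right h1 hy),
        (mul_le_mul_of_nonneg_right h2 hy).trans (le_max_right _ _)⟩
    · exact ⟨(min_le_right _ _).trans (mul_le_mul_of_nonpos_right h2 hy),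
        (mul_le_mul_of_nonpos_right h1 hy).trans (le_max_left _ _)⟩
  have hay : min (a * c) (a * d) ≤ a * y ∧ a * y ≤ max (a * c) (a * d) := by
    rcases le_total 0 a with ha | ha
    · exact ⟨(min_le_left _ _).trans (mul_le_mul_of_nonneg_left h3 ha),
        (mul_le_mul_of_nonneg_left h4 ha).trans (le_max_right _ _)⟩
    · exact ⟨(min_le_right _ _).trans (mul_le_mul_of_nonpos_left h4 ha),
        (mul_le_mul_of_nonpos_left h3 ha).trans (le_max_left _ _)⟩
  have hby : min (b * c) (b * d) ≤ b * y ∧ b * y ≤ max (b * c) (b * d) := by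
    rcases le_total 0 b with hb | hb
    · exact ⟨(min_le_left _ _).trans (mul_le_mul_of_nonneg_left h3 hb),
        (mul_le_mul_of_nonneg_left h4 hb).trans (le_max_right _ _)⟩
    · exact ⟨(min_le_right _ _).trans (mul_le_mul_of_nonpos_left h4 hb),
        (mul_le_mul_of_nonpos_left h3 hb).trans (le_max_left _ _)⟩
  constructor
  · calc min (min (a * c) (a * d)) (min (b * c) (b * d)) ≤ min (a * y) (b * y) := min_le_min hay.1 hby.1
      _ ≤ x * y := hxy.1
  · calc x * y ≤ max (a * y) (b * y) := hxy.2
      _ ≤ max (max (a * c) (a * d)) (max (b * c) (b * d)) := max_le_max hay.2 hby.2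

/-- soundness of `mul`. [folklore] -/
theorem mem_mul {I J : Ivl} {x y : ℝ} (hx : I.mem x) (hy : J.mem y) : (mul I J).mem (x * y) := by
  obtain ⟨h1, h2⟩ := hx; obtain ⟨h3, h4⟩ := hy
  have h := mul_mem_bounds h1 h2 h3 h4
  refine ⟨?_, ?_⟩ <;> simp only [mul] <;> push_cast
  · exact h.1
  · exact h.2

/-- soundness of `powInv` on a positive interval. [folklore] -/
theorem mem_powInv (n : ℕ) {I : Ivl} (hI : 0 < I.lo) {x : ℝ} (hx : I.mem x) : (powInv n I).mem (x ^ n)⁻¹ := by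
  obtain ⟨h1, h2⟩ := hx
  have hlo : (0 : ℝ) < I.lo := by exact_mod_cast hI
  have hx0 : 0 < x := lt_of_lt_of_le hlo h1
  unfold powInv
  rw [if_pos hI]
  refine ⟨?_, ?_⟩ <;> push_cast
  · exact inv_anti₀ (pow_pos hx0 n) (pow_le_pow_left₀ hx0.le h2 n)
  · exact inv_anti₀ (pow_pos hlo n) (pow_le_pow_left₀ hlo.le h1 n)

/-- `mag` bounds the absolute value of members. [folklore] -/
theorem abs_le_mag {I : Ivl} {x : ℝ} (hx : I.mem x) : |x| ≤ (mag I : ℝ) := by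
  obtain ⟨h1, h2⟩ := hx
  unfold mag
  push_cast
  rw [abs_le]
  constructor
  · have : -(|(I.lo : ℝ)|) ≤ (I.lo : ℝ) := neg_abs_le _
    have : |(I.lo : ℝ)| ≤ max |(I.lo : ℝ)| |(I.hi : ℝ)| := le_max_left _ _
    linarith
  · exact (le_abs_self _).trans ((le_max_right _ _).trans_eq' rfl) |>.trans_eq rfl |> fun h => h2.trans h

/-- members are below `hi`. [folklore] -/
theorem hi_ge {I : Ivl} {x : ℝ} (hx : I.mem x) : x ≤ (I.hi : ℝ) := hx.2

/-- members are above `lo`. [folklore] -/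
theorem lo_le {I : Ivl} {x : ℝ} (hx : I.mem x) : (I.lo : ℝ) ≤ x := hx.1

/-! ### inclusion monotonicity -/

/-- `sub` as endpoint inequalities. [folklore] -/
theorem sub_iff {I J : Ivl} : sub I J = true ↔ J.lo ≤ I.lo ∧ I.hi ≤ J.hi := by
  simp [sub]

/-- membership transfers along inclusion. [folklore] -/
theorem mem_of_sub {I J : Ivl} (h : sub I J = true) {x : ℝ} (hx : I.mem x) : J.mem x := by
  rw [sub_iff] at h
  exact ⟨(by exact_mod_cast h.1 : (J.lo : ℝ) ≤ I.lo).trans hx.1, hx.2.trans (by exact_mod_cast h.2)⟩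

/-- an interval with `lo ≤ hi` contains its endpoints (as reals). [folklore] -/
theorem mem_lo {I : Ivl} (h : I.lo ≤ I.hi) : I.mem I.lo := ⟨le_rfl, by exact_mod_cast h⟩

/-- an interval with `lo ≤ hi` contains `hi`. [folklore] -/
theorem mem_hi {I : Ivl} (h : I.lo ≤ I.hi) : I.mem I.hi := ⟨by exact_mod_cast h, le_rfl⟩

/-- nonempty intervals: `lo ≤ hi` -/
def ne (I : Ivl) : Prop := I.lo ≤ I.hi

/-- an interval with a member is nonempty. [folklore] -/
theorem ne_of_mem {I : Ivl} {x : ℝ} (hx : I.mem x) : I.ne := by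
  have : (I.lo : ℝ) ≤ I.hi := hx.1.trans hx.2
  exact_mod_cast this

/-- inclusion from real endpoint containment. [folklore] -/
theorem sub_of_real {I J : Ivl} (h1 : (J.lo : ℝ) ≤ I.lo) (h2 : (I.hi : ℝ) ≤ J.hi) : sub I J = true := by
  rw [sub_iff]; exact ⟨by exact_mod_cast h1, by exact_mod_cast h2⟩

/-- `add` is inclusion monotone. [folklore] -/
theorem add_mono {I I' J J' : Ivl} (hI : sub I I' = true) (hJ : sub J J' = true) : sub (add I J) (add I' J') = true := by
  rw [sub_iff] at *; simp only [add]; constructor <;> linarith [hI.1, hI.2, hJ.1, hJ.2]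

/-- `neg` is inclusion monotone. [folklore] -/
theorem neg_mono {I I' : Ivl} (hI : sub I I' = true) : sub (neg I) (neg I') = true := by
  rw [sub_iff] at *; simp only [neg]; constructor <;> linarith [hI.1, hI.2]

/-- `smul` is inclusion monotone. [folklore] -/
theorem smul_mono (a : ℚ) {I I' : Ivl} (hne : I.ne) (hI : sub I I' = true) : sub (smul a I) (smul a I') = true := by
  -- endpoints of `smul a I` are `a • (endpoints of I)`, which lie in `smul a I'`
  have hlo : (smul a I').mem ((a : ℝ) * I.lo) := mem_smul a (mem_of_sub hI (mem_lo hne))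
  have hhi : (smul a I').mem ((a : ℝ) * I.hi) := mem_smul a (mem_of_sub hI (mem_hi hne))
  unfold smul at hlo hhi ⊢
  split
  · rename_i ha; rw [if_pos ha] at hlo hhi
    obtain ⟨l1, -⟩ := hlo; obtain ⟨-, u2⟩ := hhi
    dsimp only at l1 u2
    refine sub_of_real ?_ ?_ <;> push_cast at l1 u2 ⊢
    · exact l1
    · exact u2
  · rename_i ha; rw [if_neg ha] at hlo hhi
    obtain ⟨-, l2⟩ := hlo; obtain ⟨u1, -⟩ := hhi
    dsimp only at l2 u1
    refine sub_of_real ?_ ?_ <;> push_cast at l2 u1 ⊢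
    · exact u1
    · exact l2

/-- `mul` is inclusion monotone. [folklore] -/
theorem mul_mono {I I' J J' : Ivl} (hIne : I.ne) (hJne : J.ne) (hI : sub I I' = true) (hJ : sub J J' = true) :
    sub (mul I J) (mul I' J') = true := by
  -- every endpoint product of `(I, J)` is a product of members of `(I', J')`
  have hp : ∀ a c : ℚ, I.mem a → J.mem c → (mul I' J').mem ((a : ℝ) * c) := fun a c ha hc =>
    mem_mul (mem_of_sub hI ha) (mem_of_sub hJ hc)
  have h1 := hp I.lo J.lo (mem_lo hIne) (mem_lo hJne)
  have h2 := hp I.lo J.hi (mem_lo hIne) (mem_hi hJne)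
  have h3 := hp I.hi J.lo (mem_hi hIne) (mem_lo hJne)
  have h4 := hp I.hi J.hi (mem_hi hIne) (mem_hi hJne)
  refine sub_of_real ?_ ?_ <;> simp only [mul] <;> push_cast
  · have e1 := h1.1; have e2 := h2.1; have e3 := h3.1; have e4 := h4.1
    simp only [mul] at e1 e2 e3 e4; push_cast at e1 e2 e3 e4
    exact le_min (le_min e1 e2) (le_min e3 e4)
  · have e1 := h1.2; have e2 := h2.2; have e3 := h3.2; have e4 := h4.2
    simp only [mul] at e1 e2 e3 e4; push_cast at e1 e2 e3 e4
    exact max_le (max_le e1 e2) (max_le e3 e4)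

/-- `powInv` is inclusion monotone (inside the positive axis). [folklore] -/
theorem powInv_mono (n : ℕ) {I I' : Ivl} (hne : I.ne) (hI : sub I I' = true) (hI' : 0 < I'.lo) :
    sub (powInv n I) (powInv n I') = true := by
  have hsub := sub_iff.mp hI
  have hIlo : 0 < I.lo := lt_of_lt_of_le hI' hsub.1
  have hlo := mem_powInv n hI' (mem_of_sub hI (mem_lo hne))
  have hhi := mem_powInv n hI' (mem_of_sub hI (mem_hi hne))
  unfold powInv at hlo hhi ⊢
  rw [if_pos hI'] at hlo hhi; rw [if_pos hIlo, if_pos hI']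
  refine sub_of_real ?_ ?_ <;> push_cast
  · have := hhi.1; push_cast at this; exact this
  · have := hlo.2; push_cast at this; exact this

/-- `mag` is inclusion monotone. [folklore] -/
theorem mag_mono {I I' : Ivl} (hne : I.ne) (hI : sub I I' = true) : mag I ≤ mag I' := by
  have h1 : |(I.lo : ℝ)| ≤ mag I' := abs_le_mag (mem_of_sub hI (mem_lo hne))
  have h2 : |(I.hi : ℝ)| ≤ mag I' := abs_le_mag (mem_of_sub hI (mem_hi hne))
  have h1' : |I.lo| ≤ mag I' := by exact_mod_cast h1
  have h2' : |I.hi| ≤ mag I' := by exact_mod_cast h2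
  exact max_le h1' h2'

/-- `hi` is inclusion monotone. [folklore] -/
theorem hi_mono {I I' : Ivl} (hI : sub I I' = true) : I.hi ≤ I'.hi := (sub_iff.mp hI).2

end Ivl

/-! ## Natural interval extension of sparse polynomials over a box -/

/-- a box: one interval per variable -/
abbrev Box := ℕ → Ivl

/-- the point `x` lies in the box `B` -/
def Box.mem (B : Box) (x : ℕ → ℝ) : Prop := ∀ v, (B v).mem (x v)

/-- box inclusion on the variables of a list -/
def Box.subOn (vars : List ℕ) (B B' : Box) : Bool := vars.all fun v => Ivl.sub (B v) (B' v)

/-- interval of a monomial -/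
def monoIvl (B : Box) : Mono → Ivl
  | [] => Ivl.const 1
  | a :: m => Ivl.mul (B a) (monoIvl B m)

/-- interval of a sparse polynomial -/
def spIvl (B : Box) : SPoly → Ivl
  | [] => Ivl.const 0
  | e :: p => Ivl.add (Ivl.smul e.2 (monoIvl B e.1)) (spIvl B p)

/-- interval of an entry of a polynomial matrix -/
def mpIvl (B : Box) : List (Mono × Mat) → Fin 3 → Fin 3 → Ivl
  | [], _, _ => Ivl.const 0
  | e :: L, i, j => Ivl.add (Ivl.smul (e.2 i j) (monoIvl B e.1)) (mpIvl B L i j)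

/-- soundness of the monomial interval. [folklore] -/
theorem mem_monoIvl {B : Box} {x : ℕ → ℝ} (hx : B.mem x) : ∀ m : Mono, (monoIvl B m).mem (monoVal x m)
  | [] => by simp [monoIvl, Ivl.const, Ivl.mem, monoVal]
  | a :: m => by
      have h : monoVal x (a :: m) = x a * monoVal x m := by simp [monoVal]
      rw [h]; exact Ivl.mem_mul (hx a) (mem_monoIvl hx m)

/-- **soundness of the polynomial interval.** [folklore] -/
theorem mem_spIvl {B : Box} {x : ℕ → ℝ} (hx : B.mem x) : ∀ p : SPoly, (spIvl B p).mem (spEval p x)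
  | [] => by simp [spIvl, Ivl.const, Ivl.mem]
  | e :: p => by
      rw [spEval_cons]
      have h1 : (Ivl.smul e.2 (monoIvl B e.1)).mem (monoVal x e.1 * (e.2 : ℝ)) := by
        rw [mul_comm]; exact Ivl.mem_smul e.2 (mem_monoIvl hx e.1)
      exact Ivl.mem_add h1 (mem_spIvl hx p)

/-- **soundness of the polynomial-matrix interval.** [folklore] -/
theorem mem_mpIvl {B : Box} {x : ℕ → ℝ} (hx : B.mem x) :
    ∀ (L : List (Mono × Mat)) (i j : Fin 3), (mpIvl B L i j).mem (matVal x L i j)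
  | [], i, j => by simp [mpIvl, Ivl.const, Ivl.mem, matVal]
  | e :: L, i, j => by
      rw [matVal_cons]
      have h1 : (Ivl.smul (e.2 i j) (monoIvl B e.1)).mem (monoVal x e.1 * (e.2 i j : ℝ)) := by
        rw [mul_comm]; exact Ivl.mem_smul (e.2 i j) (mem_monoIvl hx e.1)
      exact Ivl.mem_add h1 (mem_mpIvl hx L i j)

/-! ### monotonicity in the box (for nonempty boxes: witnessed by a member) -/

/-- the monomial interval is inclusion monotone. [folklore] -/
theorem monoIvl_mono {B B' : Box} {x : ℕ → ℝ} (hx : B.mem x) :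
    ∀ m : Mono, (∀ a ∈ m, Ivl.sub (B a) (B' a) = true) → Ivl.sub (monoIvl B m) (monoIvl B' m) = true
  | [], _ => by simp [monoIvl, Ivl.sub, Ivl.const]
  | a :: m, h => by
      simp only [monoIvl]
      exact Ivl.mul_mono (Ivl.ne_of_mem (hx a)) (Ivl.ne_of_mem (mem_monoIvl hx m))
        (h a (List.mem_cons_self ..)) (monoIvl_mono hx m fun b hb => h b (List.mem_cons_of_mem _ hb))

/-- the variables occurring in a polynomial -/
def spVars (p : SPoly) : List ℕ := p.flatMap fun e => e.1

/-- the variables occurring in a polynomial matrix -/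
def mpVars (L : List (Mono × Mat)) : List ℕ := L.flatMap fun e => e.1

/-- **monotonicity of the polynomial interval in the box.** [folklore] -/
theorem spIvl_mono {B B' : Box} {x : ℕ → ℝ} (hx : B.mem x) :
    ∀ p : SPoly, (∀ a ∈ spVars p, Ivl.sub (B a) (B' a) = true) → Ivl.sub (spIvl B p) (spIvl B' p) = true
  | [], _ => by simp [spIvl, Ivl.sub, Ivl.const]
  | e :: p, h => by
      simp only [spIvl]
      have he : ∀ a ∈ e.1, Ivl.sub (B a) (B' a) = true := fun a ha => h a (by
        unfold spVars; rw [List.flatMap_cons]; exact List.mem_append_left _ ha)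
      have hp : ∀ a ∈ spVars p, Ivl.sub (B a) (B' a) = true := fun a ha => h a (by
        unfold spVars at ha ⊢; rw [List.flatMap_cons]; exact List.mem_append_right _ ha)
      exact Ivl.add_mono (Ivl.smul_mono e.2 (Ivl.ne_of_mem (mem_monoIvl hx e.1)) (monoIvl_mono hx e.1 he))
        (spIvl_mono hx p hp)

/-- **monotonicity of the polynomial-matrix interval in the box.** [folklore] -/
theorem mpIvl_mono {B B' : Box} {x : ℕ → ℝ} (hx : B.mem x) :
    ∀ (L : List (Mono × Mat)) (i j : Fin 3), (∀ a ∈ mpVars L, Ivl.sub (B a) (B' a) = true) →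
      Ivl.sub (mpIvl B L i j) (mpIvl B' L i j) = true
  | [], i, j, _ => by simp [mpIvl, Ivl.sub, Ivl.const]
  | e :: L, i, j, h => by
      simp only [mpIvl]
      have he : ∀ a ∈ e.1, Ivl.sub (B a) (B' a) = true := fun a ha => h a (by
        unfold mpVars; rw [List.flatMap_cons]; exact List.mem_append_left _ ha)
      have hL : ∀ a ∈ mpVars L, Ivl.sub (B a) (B' a) = true := fun a ha => h a (by
        unfold mpVars at ha ⊢; rw [List.flatMap_cons]; exact List.mem_append_right _ ha)
      exact Ivl.add_mono (Ivl.smul_mono (e.2 i j) (Ivl.ne_of_mem (mem_monoIvl hx e.1)) (monoIvl_mono hx e.1 he))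
        (mpIvl_mono hx L i j hL)

/-- Anchor of this support file (registered stub of the line skeleton, lead c2): `[1,2]·[−1,3] = [−2,6]`. -/
theorem stub_certIvl : Ivl.mul ⟨1, 2⟩ ⟨-1, 3⟩ = ⟨-2, 6⟩ := by
  decide +kernel

end Summit.AtomisticToContinuum.Crystallization.Theorems.PhononStabilityCWC.Cert

end
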